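import Summits.CriticalPhenomena.PercolationContinuityZ3.Theorems.SahiCMTP2BoxCriterion
import Mathlib.MeasureTheory.Measure.Portmanteau

/-!
# Density-free cMTP₂ (Fuchs–Wang 2026, (5.1)) is closed under weak convergence

Support file of the Sahi cell (`prim-sahi`, typer seat, generation 18; `--supports stmt-CriticalPhenomena-4575`).
Theorems only (no definitions, no named facts, no sorries).

Fuchs–Wang (arXiv:2607.24394, §5) propose the density-free conditional MTP₂ property `cMTP₂^set(X_B|X_A)` (5.1) for a
random vector `X = (X_A, X_B)` and leave "an analysis of closure properties under suitable modes of convergence … for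
future research".  THIS FILE ANSWERS THE QUESTION FOR WEAK CONVERGENCE:

* **`isCMTP2Box_of_tendsto`** — if probability measures `μᵢ → μ` weakly on `ℝ^A × ℝ^B` (`A, B` finite; any filter)
  and eventually every `μᵢ` satisfies the box form of (5.1), then so does `μ`.  Portmanteau on the open interiors and the
  closed outer sets `[a − 1/(m+1), b + 1/(m+1)] × (−∞, x + 1/(m+1)]`, whose meets/joins are the outer sets of the
  meet/join sets (`prod_Iic_subset_interior_outer`, `tendsto_measure_prod_Iic_shrink_grow`), then `m → ∞` — the device
  of Colangelo–Müller–Scarsini's Theorem 2 run on the lattice of conditional-orthant events.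
* **`isCMTP2Set_of_tendsto`** (and `…_seq`) — THE CLASS OF LAWS SATISFYING (5.1) IS WEAKLY CLOSED: combine with the box
  criterion `isCMTP2Set_iff_isCMTP2Box`.

So, among the conditional-distribution notions of positive dependence, `cMTP₂^set` behaves like density-free MTP₂
(weakly closed: [CMS06] Thm. 2, tree `mIsSetTP2_of_tendsto`) and unlike stochastic monotonicity / CIS / CI in the kernel
sense (NOT weakly closed in dimension 3: `SahiCISNonClosure.lean`, `SahiCISNonClosureCI.lean`).

No sorries, no new axioms.  References: [FuchsWang2026] §5 (the question); [ColangeloMullerScarsini2006] Thm. 2 and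
[MullerStoyan2002] Thm. 1.4.9 (the device); the theorem is this work.
-/

noncomputable section

namespace Summit.CriticalPhenomena.PercolationContinuityZ3.Theorems.SahiCMTP2

open MeasureTheory Set Filter Topology Function
open Literature.Probability.LatticeModels Literature.Probability.LatticeModels.Affiliation
open scoped ENNReal SetFamily

variable {ι κ : Type*} [Fintype ι] [Fintype κ]

/-! ### Outer approximation of conditional-orthant events -/

omit [Fintype ι] in
/-- `(−∞, z] ⊆ interior (−∞, z + 1/(m+1)]` in `ℝ^B`. [this work] -/
theorem Iic_subset_interior_Iic_grow (z : κ → ℝ) (m : ℕ) : Iic z ⊆ interior (Iic (grow z m)) := by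
  have hpos : (0:ℝ) < 1 / ((m:ℝ) + 1) := by positivity
  set U : Set (κ → ℝ) := {w | ∀ i, w i < grow z m i} with hU
  have hUo : IsOpen U := by
    have : U = ⋂ i, (fun w : κ → ℝ => w i) ⁻¹' Iio (grow z m i) := by
      ext w; simp [hU]
    rw [this]
    exact isOpen_iInter_of_finite fun i => isOpen_Iio.preimage (continuous_apply i)
  have hUs : U ⊆ Iic (grow z m) := fun w hw i => (hw i).le
  intro w hw
  refine interior_maximal hUs hUo fun i => ?_
  simp only [grow]
  linarith [hw i]

/-- `[a,b] × (−∞,z] ⊆ interior ([a − 1/(m+1), b + 1/(m+1)] × (−∞, z + 1/(m+1)])`. [this work] -/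
theorem prod_Iic_subset_interior_outer (a b : ι → ℝ) (z : κ → ℝ) (m : ℕ) :
    Icc a b ×ˢ Iic z ⊆ interior (Icc (shrink a m) (grow b m) ×ˢ Iic (grow z m)) := by
  rw [interior_prod_eq]
  exact prod_mono (Icc_subset_interior_outer a b m) (Iic_subset_interior_Iic_grow z m)

omit [Fintype ι] [Fintype κ] in
/-- `⋂_m (−∞, z + 1/(m+1)] = (−∞, z]`. [this work] -/
theorem iInter_Iic_grow (z : κ → ℝ) : ⋂ m, Iic (grow z m) = Iic z := by
  refine Subset.antisymm (fun w hw i => ?_)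
    (subset_iInter fun m => Iic_subset_Iic.2 fun i => by
      simp only [grow]; linarith [show (0:ℝ) < 1 / ((m:ℝ) + 1) by positivity])
  rw [mem_iInter] at hw
  by_contra hlt
  push Not at hlt
  obtain ⟨m, hm⟩ := exists_nat_one_div_lt (sub_pos.2 hlt)
  have h2 := hw m i
  simp only [grow] at h2
  linarith

/-- The outer sets decrease to the event: `μ([a − 1/(m+1), b + 1/(m+1)] × (−∞, z + 1/(m+1)]) → μ([a,b] × (−∞,z])`.
[this work] -/
theorem tendsto_measure_prod_Iic_shrink_grow (μ : Measure ((ι → ℝ) × (κ → ℝ))) [IsFiniteMeasure μ]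
    (a b : ι → ℝ) (z : κ → ℝ) :
    Tendsto (fun m => μ (Icc (shrink a m) (grow b m) ×ˢ Iic (grow z m))) atTop (𝓝 (μ (Icc a b ×ˢ Iic z))) := by
  have hanti : Antitone fun m => Icc (shrink a m) (grow b m) ×ˢ Iic (grow z m) := fun m k hmk =>
    prod_mono (Icc_subset_Icc (shrink_mono a hmk) (fun i => by simp only [grow]; gcongr))
      (Iic_subset_Iic.2 fun i => by simp only [grow]; gcongr)
  have h := tendsto_measure_iInter_atTop (μ := μ)
    (fun m => (measurableSet_Icc.prod measurableSet_Iic).nullMeasurableSet) hanti ⟨0, measure_ne_top _ _⟩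
  have hI : (⋂ m, Icc (shrink a m) (grow b m) ×ˢ Iic (grow z m)) = Icc a b ×ˢ Iic z := by
    rw [← iInter_Icc_shrink_grow a b, ← iInter_Iic_grow z]
    ext p
    simp only [mem_iInter, mem_prod]
    exact ⟨fun h => ⟨fun m => (h m).1, fun m => (h m).2⟩, fun h m => ⟨h.1 m, h.2 m⟩⟩
  rwa [hI] at h

/-! ### Closure under weak convergence -/

/-- **The box form of (5.1) is closed under weak convergence** (any filter): if `μᵢ → μ` weakly (probability measures on
`ℝ^A × ℝ^B`) and eventually every `μᵢ` satisfies `IsCMTP2Box`, then so does `μ`: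
`μ[S]μ[T] ≤ liminf μᵢ[S_m]·liminf μᵢ[T_m] ≤ liminf(μᵢ[S_m]μᵢ[T_m]) ≤ limsup(μᵢ[meet_m]μᵢ[join_m]) ≤ μ[meet_m]μ[join_m] → μ[meet]μ[join]`.
[this work] -/
theorem isCMTP2Box_of_tendsto {T : Type*} {L : Filter T} [NeBot L]
    {μs : T → ProbabilityMeasure ((ι → ℝ) × (κ → ℝ))} {μ : ProbabilityMeasure ((ι → ℝ) × (κ → ℝ))}
    (hconv : Tendsto μs L (𝓝 μ))
    (h : ∀ᶠ i in L, IsCMTP2Box (μs i : Measure ((ι → ℝ) × (κ → ℝ)))) :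
    IsCMTP2Box (μ : Measure ((ι → ℝ) × (κ → ℝ))) := by
  intro a b a' b' x y
  -- the closed outer sets
  set E : (ι → ℝ) → (ι → ℝ) → (κ → ℝ) → ℕ → Set ((ι → ℝ) × (κ → ℝ)) :=
    fun c d z m => Icc (shrink c m) (grow d m) ×ˢ Iic (grow z m) with hE
  have hliminf : ∀ (m : ℕ) (c d : ι → ℝ) (z : κ → ℝ),
      (μ : Measure ((ι → ℝ) × (κ → ℝ))) (Icc c d ×ˢ Iic z) ≤
        liminf (fun i => (μs i : Measure ((ι → ℝ) × (κ → ℝ))) (E c d z m)) L := fun m c d z =>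
    calc (μ : Measure ((ι → ℝ) × (κ → ℝ))) (Icc c d ×ˢ Iic z)
        ≤ (μ : Measure ((ι → ℝ) × (κ → ℝ))) (interior (E c d z m)) :=
          measure_mono (prod_Iic_subset_interior_outer c d z m)
      _ ≤ liminf (fun i => (μs i : Measure ((ι → ℝ) × (κ → ℝ))) (interior (E c d z m))) L :=
          ProbabilityMeasure.le_liminf_measure_open_of_tendsto hconv isOpen_interior
      _ ≤ liminf (fun i => (μs i : Measure ((ι → ℝ) × (κ → ℝ))) (E c d z m)) L :=
          liminf_le_liminf (Eventually.of_forall fun i => measure_mono interior_subset)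
  have hlimsup : ∀ (m : ℕ) (c d : ι → ℝ) (z : κ → ℝ),
      limsup (fun i => (μs i : Measure ((ι → ℝ) × (κ → ℝ))) (E c d z m)) L ≤
        (μ : Measure ((ι → ℝ) × (κ → ℝ))) (E c d z m) := fun m c d z =>
    ProbabilityMeasure.limsup_measure_closed_le_of_tendsto hconv (isClosed_Icc.prod isClosed_Iic)
  have step : ∀ m : ℕ,
      (μ : Measure ((ι → ℝ) × (κ → ℝ))) (Icc a b ×ˢ Iic x) *
          (μ : Measure ((ι → ℝ) × (κ → ℝ))) (Icc a' b' ×ˢ Iic y) ≤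
        (μ : Measure ((ι → ℝ) × (κ → ℝ))) (E (a ⊓ a') (b ⊓ b') (x ⊓ y) m) *
          (μ : Measure ((ι → ℝ) × (κ → ℝ))) (E (a ⊔ a') (b ⊔ b') (x ⊔ y) m) := by
    intro m
    set u : T → ℝ≥0∞ := fun i => (μs i : Measure ((ι → ℝ) × (κ → ℝ))) (E a b x m)
    set v : T → ℝ≥0∞ := fun i => (μs i : Measure ((ι → ℝ) × (κ → ℝ))) (E a' b' y m)
    set mm : T → ℝ≥0∞ := fun i => (μs i : Measure ((ι → ℝ) × (κ → ℝ))) (E (a ⊓ a') (b ⊓ b') (x ⊓ y) m)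
    set jj : T → ℝ≥0∞ := fun i => (μs i : Measure ((ι → ℝ) × (κ → ℝ))) (E (a ⊔ a') (b ⊔ b') (x ⊔ y) m)
    have huv : ∀ᶠ i in L, (u * v) i ≤ (mm * jj) i := h.mono fun i hi => by
      have h1 := hi (shrink a m) (grow b m) (shrink a' m) (grow b' m) (grow x m) (grow y m)
      rwa [shrink_inf, shrink_sup, grow_inf, grow_sup, grow_inf, grow_sup] at h1
    have hmfin : limsup mm L ≠ ∞ := ne_top_of_le_ne_top (measure_ne_top _ _) (hlimsup m _ _ _)
    have hjfin : limsup jj L ≠ ∞ := ne_top_of_le_ne_top (measure_ne_top _ _) (hlimsup m _ _ _)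
    calc (μ : Measure ((ι → ℝ) × (κ → ℝ))) (Icc a b ×ˢ Iic x) *
          (μ : Measure ((ι → ℝ) × (κ → ℝ))) (Icc a' b' ×ˢ Iic y)
        ≤ liminf u L * liminf v L := mul_le_mul' (hliminf m a b x) (hliminf m a' b' y)
      _ ≤ liminf (u * v) L := ENNReal.le_liminf_mul
      _ ≤ liminf (mm * jj) L := liminf_le_liminf huv
      _ ≤ limsup (mm * jj) L := liminf_le_limsup
      _ ≤ limsup mm L * limsup jj L := ENNReal.limsup_mul_le' (Or.inr hjfin) (Or.inl hmfin)
      _ ≤ _ := mul_le_mul' (hlimsup m _ _ _) (hlimsup m _ _ _)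
  exact ge_of_tendsto' (ENNReal.Tendsto.mul
    (tendsto_measure_prod_Iic_shrink_grow (μ : Measure ((ι → ℝ) × (κ → ℝ))) (a ⊓ a') (b ⊓ b') (x ⊓ y))
    (Or.inr (measure_ne_top _ _))
    (tendsto_measure_prod_Iic_shrink_grow (μ : Measure ((ι → ℝ) × (κ → ℝ))) (a ⊔ a') (b ⊔ b') (x ⊔ y))
    (Or.inr (measure_ne_top _ _))) step

/-- **FUCHS–WANG'S DENSITY-FREE cMTP₂ (5.1) IS CLOSED UNDER WEAK CONVERGENCE** (filter form): if probability measures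
`μᵢ → μ` weakly on `ℝ^A × ℝ^B` and eventually every `μᵢ` satisfies `cMTP₂^set(X_B|X_A)`, then so does `μ` — answering
the closure question of [FuchsWang2026] §5 for weak convergence. [this work] -/
theorem isCMTP2Set_of_tendsto {T : Type*} {L : Filter T} [NeBot L]
    {μs : T → ProbabilityMeasure ((ι → ℝ) × (κ → ℝ))} {μ : ProbabilityMeasure ((ι → ℝ) × (κ → ℝ))}
    (hconv : Tendsto μs L (𝓝 μ))
    (h : ∀ᶠ i in L, IsCMTP2Set (μs i : Measure ((ι → ℝ) × (κ → ℝ)))) :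
    IsCMTP2Set (μ : Measure ((ι → ℝ) × (κ → ℝ))) :=
  isCMTP2Set_of_isCMTP2Box _ (isCMTP2Box_of_tendsto hconv (h.mono fun _ hi => isCMTP2Box_of_isCMTP2Set hi))

/-- **Sequence form.** [this work] -/
theorem isCMTP2Set_of_tendsto_seq {μs : ℕ → ProbabilityMeasure ((ι → ℝ) × (κ → ℝ))}
    {μ : ProbabilityMeasure ((ι → ℝ) × (κ → ℝ))} (hconv : Tendsto μs atTop (𝓝 μ))
    (h : ∀ n, IsCMTP2Set (μs n : Measure ((ι → ℝ) × (κ → ℝ)))) :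
    IsCMTP2Set (μ : Measure ((ι → ℝ) × (κ → ℝ))) :=
  isCMTP2Set_of_tendsto hconv (Eventually.of_forall h)

/-! ### The neighbours of (5.1) in [FuchsWang2026] Fig. 2.2 are weakly closed too: MTP₂ of the cdf, LTD -/

omit [Fintype ι] in
/-- The outer orthants decrease to the orthant: `μ(−∞, z + 1/(m+1)] → μ(−∞, z]`. [this work] -/
theorem tendsto_measure_Iic_grow (μ : Measure (κ → ℝ)) [IsFiniteMeasure μ] (z : κ → ℝ) :
    Tendsto (fun m => μ (Iic (grow z m))) atTop (𝓝 (μ (Iic z))) := by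
  have hanti : Antitone fun m => Iic (grow z m) := fun m k hmk =>
    Iic_subset_Iic.2 fun i => by simp only [grow]; gcongr
  have h := tendsto_measure_iInter_atTop (μ := μ) (fun m => measurableSet_Iic.nullMeasurableSet) hanti
    ⟨0, measure_ne_top _ _⟩
  rwa [iInter_Iic_grow] at h

omit [Fintype ι] in
/-- **MTP₂ of the distribution function ("MTP₂(X)") is closed under weak convergence** on `ℝ^B` (any filter): the same
portmanteau device on the orthants `(−∞, z + 1/(m+1)]`. [this work] -/
theorem isCdfMTP2_of_tendsto {T : Type*} {L : Filter T} [NeBot L] {μs : T → ProbabilityMeasure (κ → ℝ)}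
    {μ : ProbabilityMeasure (κ → ℝ)} (hconv : Tendsto μs L (𝓝 μ))
    (h : ∀ᶠ i in L, IsCdfMTP2 (μs i : Measure (κ → ℝ))) : IsCdfMTP2 (μ : Measure (κ → ℝ)) := by
  intro x y
  have hliminf : ∀ (m : ℕ) (z : κ → ℝ), (μ : Measure (κ → ℝ)) (Iic z) ≤
      liminf (fun i => (μs i : Measure (κ → ℝ)) (Iic (grow z m))) L := fun m z =>
    calc (μ : Measure (κ → ℝ)) (Iic z) ≤ (μ : Measure (κ → ℝ)) (interior (Iic (grow z m))) :=
          measure_mono (Iic_subset_interior_Iic_grow z m)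
      _ ≤ liminf (fun i => (μs i : Measure (κ → ℝ)) (interior (Iic (grow z m)))) L :=
          ProbabilityMeasure.le_liminf_measure_open_of_tendsto hconv isOpen_interior
      _ ≤ liminf (fun i => (μs i : Measure (κ → ℝ)) (Iic (grow z m))) L :=
          liminf_le_liminf (Eventually.of_forall fun i => measure_mono interior_subset)
  have hlimsup : ∀ (m : ℕ) (z : κ → ℝ),
      limsup (fun i => (μs i : Measure (κ → ℝ)) (Iic (grow z m))) L ≤ (μ : Measure (κ → ℝ)) (Iic (grow z m)) :=
    fun m z => ProbabilityMeasure.limsup_measure_closed_le_of_tendsto hconv isClosed_Iic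
  have step : ∀ m : ℕ, (μ : Measure (κ → ℝ)) (Iic x) * (μ : Measure (κ → ℝ)) (Iic y) ≤
      (μ : Measure (κ → ℝ)) (Iic (grow (x ⊓ y) m)) * (μ : Measure (κ → ℝ)) (Iic (grow (x ⊔ y) m)) := by
    intro m
    set u : T → ℝ≥0∞ := fun i => (μs i : Measure (κ → ℝ)) (Iic (grow x m))
    set v : T → ℝ≥0∞ := fun i => (μs i : Measure (κ → ℝ)) (Iic (grow y m))
    set mm : T → ℝ≥0∞ := fun i => (μs i : Measure (κ → ℝ)) (Iic (grow (x ⊓ y) m))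
    set jj : T → ℝ≥0∞ := fun i => (μs i : Measure (κ → ℝ)) (Iic (grow (x ⊔ y) m))
    have huv : ∀ᶠ i in L, (u * v) i ≤ (mm * jj) i := h.mono fun i hi => by
      have h1 := hi (grow x m) (grow y m)
      rwa [grow_inf, grow_sup] at h1
    have hmfin : limsup mm L ≠ ∞ := ne_top_of_le_ne_top (measure_ne_top _ _) (hlimsup m _)
    have hjfin : limsup jj L ≠ ∞ := ne_top_of_le_ne_top (measure_ne_top _ _) (hlimsup m _)
    calc (μ : Measure (κ → ℝ)) (Iic x) * (μ : Measure (κ → ℝ)) (Iic y)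
        ≤ liminf u L * liminf v L := mul_le_mul' (hliminf m x) (hliminf m y)
      _ ≤ liminf (u * v) L := ENNReal.le_liminf_mul
      _ ≤ liminf (mm * jj) L := liminf_le_liminf huv
      _ ≤ limsup (mm * jj) L := liminf_le_limsup
      _ ≤ limsup mm L * limsup jj L := ENNReal.limsup_mul_le' (Or.inr hjfin) (Or.inl hmfin)
      _ ≤ _ := mul_le_mul' (hlimsup m _) (hlimsup m _)
  exact ge_of_tendsto' (ENNReal.Tendsto.mul (tendsto_measure_Iic_grow (μ : Measure (κ → ℝ)) (x ⊓ y))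
    (Or.inr (measure_ne_top _ _)) (tendsto_measure_Iic_grow (μ : Measure (κ → ℝ)) (x ⊔ y))
    (Or.inr (measure_ne_top _ _))) step

/-! ### The paper's coordinates: a law on `ℝ^δ` and a partition of the index set -/

/-- **Closure in the paper's coordinates**: for probability measures `μᵢ → μ` weakly on `ℝ^δ` (`δ` finite) and a
partition `A = {i | p i}`, `B = {i | ¬ p i}`, if eventually `cMTP₂^set((Xᵢ)_B | (Xᵢ)_A)` (`IsCMTP2SetAt p`), then the
same holds for the limit (push forward along the homeomorphism `ℝ^δ ≃ ℝ^A × ℝ^B`). [this work] -/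
theorem isCMTP2SetAt_of_tendsto {δ : Type*} [Fintype δ] (p : δ → Prop) [DecidablePred p]
    {T : Type*} {L : Filter T} [NeBot L] {μs : T → ProbabilityMeasure (δ → ℝ)} {μ : ProbabilityMeasure (δ → ℝ)}
    (hconv : Tendsto μs L (𝓝 μ)) (h : ∀ᶠ i in L, IsCMTP2SetAt p (μs i : Measure (δ → ℝ))) :
    IsCMTP2SetAt p (μ : Measure (δ → ℝ)) := by
  have hcont : Continuous (MeasurableEquiv.piEquivPiSubtypeProd (fun _ : δ => ℝ) p) :=
    (Continuous.prodMk (continuous_pi fun i => continuous_apply _) (continuous_pi fun i => continuous_apply _))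
  have hlim := ProbabilityMeasure.tendsto_map_of_tendsto_of_continuous μs μ hconv hcont
  have key := isCMTP2Set_of_tendsto (ι := {i // p i}) (κ := {i // ¬ p i}) hlim
    (h.mono fun i hi => by simpa only [IsCMTP2SetAt, ProbabilityMeasure.toMeasure_map] using hi)
  simpa only [IsCMTP2SetAt, ProbabilityMeasure.toMeasure_map] using key

end Summit.CriticalPhenomena.PercolationContinuityZ3.Theorems.SahiCMTP2
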